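import Summits.KontsevichZagierPeriods.KontsevichZagierPeriods.Theorems.LinRedNormalFormHoffmanSpanInKZModTables
import Mathlib.Tactic.NormNum.Prime

/-!
# Crux `LinRedNormalForm.HoffmanSpanInKZ` (stmt-KontsevichZagierPeriods-15044), line `Sketch`:
# EDS certificates from transcripts checked MODULO A PRIME — assembly (registered stub `stub_modCert`)

`edsCertificate_of_ptables`: if the derived table and the word table of weight `N` check modulo a prime
`p` (`dtableOkP`, `wtableOkP` of `LinRedNormalFormHoffmanSpanInKZModTables`) and the word table covers the
admissible words, then `EdsCertificate N`.  With coverage, ALL admissible unit vectors lie in `spanP p N`;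
restricting to the admissible coordinates, the reductions of the restricted integer family span `(ZMod p)^A`,
hence (bridge `span_toQ_eq_top_of_span_redP_eq_top`) its rational images span `ℚ^A`; the rational image of
every element of the generating family `GZ N` carries an `EdsCertificate` clause (`Gen.clause`, Hoffman
units) and vanishes off the admissible words, two properties preserved by the span; so the unique preimage
of an admissible unit vector is that unit vector itself and carries a clause.  Also: the modulus `65521`
of the tables is prime (`Fact` instance).

Sources: the reflection set-up of the Derived files (this tree); rank inequality under reduction mod `p`
(`LinRedNormalFormHoffmanSpanInKZModBridge`). [folklore]
-/

namespace Summit.KontsevichZagierPeriods.LinRedNormalForm.HoffmanSpanInKZ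

open Literature.NumberTheory.Transcendental
open Summit.KontsevichZagierPeriods.MzvKernelInKZ.Negative
open Summit.KontsevichZagierPeriods.MzvKernelInKZ.TwoPosets
open Submodule

/-! ## From spanning modulo `p` to `EdsCertificate N` -/

section Assembly

variable {N : ℕ}

/-- The rational image of every element of the generating family carries a clause and vanishes off the
admissible words. [folklore] -/
theorem clause_and_supp_of_mem_GZ (v : (Fin N → Bool) → ℤ) (hv : v ∈ GZ N) :
    Clause N (toQ v) ∧ ∀ ε, ¬ Adm ε → toQ v ε = 0 := by
  rcases hv with ⟨g, hg, ha, rfl⟩ | ⟨h, hh, hw, hadm, rfl⟩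
  · refine ⟨by rw [toQ_vecZ]; exact Gen.clause N g hg, fun ε hε => ?_⟩
    simp only [toQ, Gen.vecZ, evalG_eq_zero_of_admOk N _ ha ε hε, Int.cast_zero]
  · refine ⟨?_, fun ε hε => ?_⟩
    · rw [toQ_single]
      simpa using clause_hoffman (N := N) [(h, 1)] (by simpa using ⟨hh, hw⟩)
    · have hne : ε ≠ bword N h := fun e => hε (e ▸ hadm)
      simp [toQ, hne]

/-- Hence every element of the rational span carries a clause and vanishes off the admissible words.
[folklore] -/
theorem clause_and_supp_of_mem_span (a : Vec N) (ha : a ∈ span ℚ (toQ '' GZ N)) :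
    Clause N a ∧ ∀ ε, ¬ Adm ε → a ε = 0 := by
  induction ha using Submodule.span_induction with
  | mem x hx =>
    obtain ⟨v, hv, rfl⟩ := hx
    exact clause_and_supp_of_mem_GZ v hv
  | zero => exact ⟨clause_zero, fun _ _ => rfl⟩
  | add x y _ _ hx hy => exact ⟨clause_add hx.1 hy.1, fun ε hε => by simp [hx.2 ε hε, hy.2 ε hε]⟩
  | smul r x _ hx => exact ⟨clause_smul r hx.1, fun ε hε => by simp [hx.2 ε hε]⟩

/-- **From all admissible unit vectors in `spanP` to `EdsCertificate N`.**  Restricting to the admissible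
coordinates, the reductions of the restricted integer family span `(ZMod p)^A`, hence (bridge) its rational
images span `ℚ^A`; every element of the rational span of `GZ N` carries a clause and vanishes off the
admissible words, so the preimage of an admissible unit vector is that unit vector and carries a clause.
[folklore] -/
theorem edsCertificate_of_unitP (p N : ℕ) [Fact p.Prime]
    (hunit : ∀ ε : Fin N → Bool, Adm ε → (Pi.single ε (1 : ZMod p) : (Fin N → Bool) → ZMod p) ∈ spanP p N) :
    EdsCertificate N := by
  classical
  -- restriction to the admissible coordinates
  let A := {ε : Fin N → Bool // Adm ε}
  let S : Set (A → ℤ) := (fun v : (Fin N → Bool) → ℤ => v ∘ Subtype.val) '' GZ N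
  have hS : span (ZMod p) (redP p '' S) = ⊤ := by
    have himg : redP p '' S = (LinearMap.funLeft (ZMod p) (ZMod p) (Subtype.val : A → _)) '' (redP p '' GZ N) := by
      simp only [S, Set.image_image]
      rfl
    rw [himg, ← Submodule.map_span, eq_top_iff]
    rintro x -
    rw [pi_eq_sum_univ' x]
    refine sum_mem fun a _ => smul_mem _ _ ⟨Pi.single a.1 1, hunit a.1 a.2, ?_⟩
    funext b
    by_cases hba : b = a
    · subst hba
      simp [LinearMap.funLeft_apply]
    · have hba' : (b : Fin N → Bool) ≠ a := fun e => hba (Subtype.ext e)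
      simp [LinearMap.funLeft_apply, hba, hba']
  have hQ := span_toQ_eq_top_of_span_redP_eq_top p S hS
  -- the target unit vector, restricted, lies in the restricted rational span
  intro w hw
  have hmem : (Pi.single (⟨w, hw⟩ : A) (1 : ℚ) : A → ℚ) ∈
      (span ℚ (toQ '' GZ N)).map (LinearMap.funLeft ℚ ℚ (Subtype.val : A → _)) := by
    rw [Submodule.map_span]
    have himg : (LinearMap.funLeft ℚ ℚ (Subtype.val : A → _)) '' (toQ '' GZ N) = toQ '' S := by
      simp only [S, Set.image_image]
      rfl
    rw [himg, hQ]
    trivial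
  obtain ⟨a, ha, hres⟩ := Submodule.mem_map.1 hmem
  obtain ⟨hcl, hsupp⟩ := clause_and_supp_of_mem_span a ha
  have heq : a = unitVec N w := by
    funext ε
    by_cases hε : Adm ε
    · have := congrFun hres ⟨ε, hε⟩
      by_cases hεw : ε = w
      · subst hεw
        simp only [LinearMap.funLeft_apply, Pi.single_eq_same] at this
        rw [this, unitVec, Pi.single_eq_same]
      · have hne : (⟨ε, hε⟩ : A) ≠ ⟨w, hw⟩ := fun e => hεw (congrArg Subtype.val e)
        simp only [LinearMap.funLeft_apply] at this
        rw [Pi.single_apply, if_neg hne] at this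
        rw [this, unitVec, Pi.single_apply, if_neg hεw]
    · have hne : ε ≠ w := fun e => hε (e ▸ hw)
      rw [hsupp ε hε, unitVec, Pi.single_apply, if_neg hne]
  rw [← heq]
  exact hcl

/-- **From checked mod-`p` tables to `EdsCertificate N`.** [folklore] -/
theorem edsCertificate_of_ptables (p N : ℕ) [Fact p.Prime] (Δ : List DRowP) (T : List WRowP)
    (hΔ : dtableOkP p N [] Δ = true) (hT : wtableOkP p N (Δ.map (DRowP.vvec p N)) [] T = true)
    (hcover : (allWords N).all (fun l => decide (Adm (wordOf N l) → l ∈ T.map fun c => wordOfCode N c.w)) =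
      true) : EdsCertificate N := by
  have hdv : ∀ v ∈ Δ.map (DRowP.vvec p N), evalG (ZMod p) N v ∈ spanP p N := fun v hv =>
    mem_spanP_of_dtableOkP Δ [] (fun v hv => by simp at hv) hΔ v (by simpa using hv)
  have hT' := uP_mem_spanP_of_wtableOkP _ hdv T [] (fun c hc => by simp at hc) hT
  refine edsCertificate_of_unitP p N fun ε hε => ?_
  have hl : List.ofFn ε ∈ allWords N := by simpa using mem_allWords (List.ofFn ε)
  have := of_decide_eq_true ((List.all_eq_true.1 hcover) _ hl)
  rw [wordOf_ofFn] at this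
  obtain ⟨c, hc, hcw⟩ := List.mem_map.1 (this hε)
  have hu := hT' c hc
  rwa [uP, hcw, wordOf_ofFn] at hu

end Assembly

/-! ## The prime used by the tables -/

/-- `65521`, the largest prime below `2^16`, is prime (the modulus of the weight-`≥ 11` tables). [folklore] -/
theorem prime_65521 : Nat.Prime 65521 := by norm_num

/-- The primality of `65521` as a `Fact` instance (for `ZMod 65521` to be a field). [folklore] -/
instance fact_prime_65521 : Fact (Nat.Prime 65521) := ⟨prime_65521⟩

/-! ## The registered stub -/

/-- Soundness of mod-`p` transcripts, as a statement about this file's checkers (not a published fact). -/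
def ModCertSound : Prop :=
  ∀ (p N : ℕ) [Fact p.Prime] (Δ : List DRowP) (T : List WRowP), dtableOkP p N [] Δ = true →
    wtableOkP p N (Δ.map (DRowP.vvec p N)) [] T = true →
      (allWords N).all (fun l => decide (Adm (wordOf N l) → l ∈ T.map fun c => wordOfCode N c.w)) = true →
        EdsCertificate N

/-- **Registered stub `stub_modCert`** of the skeleton of line `Sketch`. -/
theorem stub_modCert : ModCertSound := fun p N _ Δ T h₁ h₂ h₃ => edsCertificate_of_ptables p N Δ T h₁ h₂ h₃


/-! ## Smoke test (kernel), weight `4`, modulo `65521` -/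

example : dtableOkP 65521 4 []
    [⟨.F [2] [2], [], [(1, 65520), (3, 4)]⟩,
     ⟨.D [3], [(0, 49141)], [(1, 16381), (5, 65520)]⟩,
     ⟨.K [2, 1, 1], [], [(1, 65520), (7, 1)]⟩] = true := by
  decide +kernel

example : wtableOkP 65521 4 ([⟨.F [2] [2], [], [(1, 65520), (3, 4)]⟩,
     ⟨.D [3], [(0, 49141)], [(1, 16381), (5, 65520)]⟩,
     ⟨.K [2, 1, 1], [], [(1, 65520), (7, 1)]⟩].map (DRowP.vvec 65521 4)) []
    [⟨5, [], [([2, 2], 1)], []⟩,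
     ⟨1, [], [([2, 2], 43682)], [(1, 43682)]⟩,
     ⟨3, [(1, 49141)], [], [(0, 49141)]⟩,
     ⟨7, [(1, 1)], [], [(2, 1)]⟩] = true := by
  decide +kernel

end Summit.KontsevichZagierPeriods.LinRedNormalForm.HoffmanSpanInKZ
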